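import Summits.NavierStokesRegularity.NavierStokesRegularity.Theorems.OddMorawetzLocal.Negative.OddMorawetzLocalSymmetryDefs
import HarnessLib

/-!
# Three small lemmas for the refutation of crux `OddMorawetzLocal` (stmt-NavierStokesRegularity-1376)

Mathlib plus the tree's symmetry vocabulary (`OddMorawetz.signedPerm`, `OddMorawetz.signedPermLI_apply`);
no named facts.  The refutation averages a certificate over `O(3) = Matrix.unitaryGroup (Fin 3) ℝ`; the three
registered stubs served here are:

* `fderiv_apply_eq_of_eqOn_submodule` — two differentiable functions which agree on a linear subspace `S` have
  the same directional derivative `fderiv ℝ f z w` at every `z ∈ S` in every direction `w ∈ S` (restrict to the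
  line `t ↦ z + t • w ⊂ S` and use uniqueness of one-variable derivatives);
* `rotPath_mem_unitaryGroup` — the rational parametrisation `((1 - t²)/(1 + t²), 2t/(1 + t²))` of the rotations
  about the third axis lies in `O(3)` for every real `t`;
* `signedPermMatrix_mem_and_apply` — the matrix `(i, j) ↦ [j = σ⁻¹ i] ε i` of the signed coordinate permutation
  `signedPerm σ ε` (hyperoctahedral group `B₃`) is orthogonal and its `mulVec` action is `signedPerm σ ε`.
-/

noncomputable section

set_option linter.dupNamespace false

namespace Summit.NavierStokesRegularity.NavierStokesRegularity.Theorems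

/-- **Directional derivatives along a subspace only see the restriction to the subspace.**  If `f` and `g` are
differentiable and agree on the submodule `S`, then `fderiv ℝ f z w = fderiv ℝ g z w` for all `z, w ∈ S`
(stub `fderiv_apply_eq_of_eqOn_submodule` of crux `OddMorawetzLocal`). -/
theorem fderiv_apply_eq_of_eqOn_submodule {E : Type*} [NormedAddCommGroup E] [NormedSpace ℝ E]
    (S : Submodule ℝ E) {f g : E → ℝ} (hf : Differentiable ℝ f) (hg : Differentiable ℝ g)
    (h : ∀ z ∈ S, f z = g z) {z w : E} (hz : z ∈ S) (hw : w ∈ S) :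
    fderiv ℝ f z w = fderiv ℝ g z w := by
  -- the line `t ↦ z + t • w` stays inside `S` and has velocity `w`
  have hline : ∀ t : ℝ, z + t • w ∈ S := fun t => S.add_mem hz (S.smul_mem t hw)
  have hγ : HasDerivAt (fun t : ℝ => z + t • w) w 0 := by
    simpa using ((hasDerivAt_id (0 : ℝ)).smul_const w).const_add z
  have hz0 : z = z + (0 : ℝ) • w := by simp
  have hf' : HasDerivAt (fun t : ℝ => f (z + t • w)) (fderiv ℝ f z w) 0 :=
    (hf z).hasFDerivAt.comp_hasDerivAt_of_eq (0 : ℝ) hγ hz0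
  have hg' : HasDerivAt (fun t : ℝ => g (z + t • w)) (fderiv ℝ g z w) 0 :=
    (hg z).hasFDerivAt.comp_hasDerivAt_of_eq (0 : ℝ) hγ hz0
  -- along the line the two functions coincide
  have hfg : (fun t : ℝ => f (z + t • w)) = fun t : ℝ => g (z + t • w) :=
    funext fun t => h _ (hline t)
  rw [hfg] at hf'
  exact hf'.unique hg'

/-- **The rational rotation path lies in `O(3)`.**  For every real `t`, the matrix of the rotation about the third
axis with cosine `(1 - t²)/(1 + t²)` and sine `2t/(1 + t²)` belongs to `Matrix.unitaryGroup (Fin 3) ℝ`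
(stub `rotPath_mem_unitaryGroup` of crux `OddMorawetzLocal`). -/
theorem rotPath_mem_unitaryGroup (t : ℝ) :
    (Matrix.of fun i j : Fin 3 =>
        if i = 0 ∧ j = 0 then (1 - t ^ 2) / (1 + t ^ 2) else if i = 0 ∧ j = 1 then -(2 * t) / (1 + t ^ 2) else
        if i = 1 ∧ j = 0 then (2 * t) / (1 + t ^ 2) else if i = 1 ∧ j = 1 then (1 - t ^ 2) / (1 + t ^ 2) else
        if i = 2 ∧ j = 2 then 1 else 0 : Matrix (Fin 3) (Fin 3) ℝ) ∈ Matrix.unitaryGroup (Fin 3) ℝ := by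
  rw [Matrix.mem_unitaryGroup_iff]
  have ht : (1 + t ^ 2 : ℝ) ≠ 0 := by positivity
  ext i j
  fin_cases i <;> fin_cases j <;>
    simp [Matrix.mul_apply, Fin.sum_univ_three, Matrix.star_eq_conjTranspose] <;>
    field_simp <;> ring

/-- **Signed coordinate permutations as orthogonal matrices.**  For `σ ∈ 𝔖₃` and signs `ε`, the matrix
`(i, j) ↦ [j = σ⁻¹ i] ε i` is in `Matrix.unitaryGroup (Fin 3) ℝ`, and its action `x ↦ A *ᵥ x` on `ℝ³`
(transported through `WithLp`) is the tree's isometry `OddMorawetz.signedPerm σ ε`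
(stub `signedPermMatrix_mem_and_apply` of crux `OddMorawetzLocal`). -/
theorem signedPermMatrix_mem_and_apply (σ : Equiv.Perm (Fin 3)) (ε : Fin 3 → ℤˣ) :
    (Matrix.of fun i j : Fin 3 => if j = σ.symm i then ((ε i : ℤ) : ℝ) else 0) ∈ Matrix.unitaryGroup (Fin 3) ℝ ∧
      ∀ x : EuclideanSpace ℝ (Fin 3),
        WithLp.toLp 2 ((Matrix.of fun i j : Fin 3 => if j = σ.symm i then ((ε i : ℤ) : ℝ) else 0).mulVec
          (WithLp.ofLp x)) = Summit.NavierStokesRegularity.NavierStokesRegularity.Theorems.OddMorawetz.signedPerm σ ε x := by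
  -- the signs square to one
  have hε : ∀ i, ((ε i : ℤ) : ℝ) * ((ε i : ℤ) : ℝ) = 1 := by
    intro i
    rcases Int.units_eq_one_or (ε i) with h | h <;> simp [h]
  refine ⟨?_, ?_⟩
  · rw [Matrix.mem_unitaryGroup_iff]
    ext i k
    simp only [Matrix.mul_apply, Matrix.star_eq_conjTranspose, Matrix.conjTranspose_apply, Matrix.of_apply,
      star_trivial, Matrix.one_apply]
    rw [Finset.sum_eq_single (σ.symm i)]
    · by_cases hik : i = k
      · subst hik
        simp [hε i]
      · have hne : σ.symm i ≠ σ.symm k := fun h' => hik (σ.symm.injective h')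
        simp [hne, hik]
    · intro j _ hj
      simp [hj]
    · intro hi
      exact absurd (Finset.mem_univ _) hi
  · intro x
    ext i
    simp only [Matrix.mulVec, dotProduct, Matrix.of_apply, OddMorawetz.signedPerm,
      OddMorawetz.signedPermLI_apply]
    rw [Finset.sum_eq_single (σ.symm i)]
    · simp
    · intro j _ hj
      simp [hj]
    · intro hi
      exact absurd (Finset.mem_univ _) hi

end Summit.NavierStokesRegularity.NavierStokesRegularity.Theorems

end
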